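import Summits.CriticalPhenomena.PercolationContinuityZ3.Theses.PercNearOneGluing
import Literature.Probability.Percolation.PercolationProofs

/-!
# Disproof of `AdditiveGluing` — standing adversary file (cdisprove, stmt-CriticalPhenomena-4576)

Crux (route `PercNearOneGluing`, decl `AdditiveGluing`): on every finite weighted graph
(vertices `Fin n`, weights `w : Sym2 (Fin n) → [0,1]`, measure `prodBernoulli w`),
`P(o ↔ A) − t ≤ P(o ↔ b)` whenever `0 ≤ t` and `P(a ↔ b) ≥ 1 − t` for every `a ∈ A`.
Equivalently `P(E) ≤ max_{a∈A} P(a ↮ b)` with `E := {o ↔ A} \ {o ↔ b} = ⋃_{a∈A} {o ↔ a, a ↮ b}`.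

## Findings (index; details in the docstrings below)
* (a) LOAD-BEARING hypotheses — both are needed:
  `additiveGluing_false_without_nonneg` (drop `0 ≤ t`: `A = ∅, t = −2`),
  `additiveGluing_false_without_relay` (drop the relay hypothesis: two isolated vertices, `A = {o}`).
* (b) TIGHTNESS — `additiveGluing_eq_of_mem`: if `o ∈ A` the inequality is an EQUALITY at the
  admissible slack `t = P(o ↮ b)` (this is the `ratio 1.000` family of Kozma–Nitzan's numerics and of
  the planner/refuter sweeps: `o ≡ a`); `additiveGluing_of_mem`: and it holds there.
* (c) REFUTED NATURAL STRENGTHENINGS — `not_additiveGluingAvg`: `max_a P(a ↮ b)` cannot be replaced by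
  the average over `A` (witness with 0/1 weights); the DIRECTED analogue of AG is FALSE (comment
  `directed_analogue_fails`: 5 vertices, |A| = 3, P(E) = 19/64 > 18/64 = max_a P(a ↛ b)), so any proof
  must use the symmetry of `↔` — exactly as for KN Conjecture 1 (KN §5.7 gives 7/16 < 15/32 for Conj 1;
  that directed example does NOT break the additive form, ours does).
* (d) POSITIVE special cases (evidence for provers, not landable by a refuter):
  `additiveGluing_of_card_le_one` (|A| ≤ 1, the union bound). In print: |A| = 2 (KN Thm 1 ⇒ Conj 2 ⇒
  Conj 1 ⇒ AG), `o` with all neighbours in `A` (KN Thm 4), `o`–`x`–`A` chains (KN Thm 5). Hence a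
  counterexample needs |A| ≥ 3 AND at least one 'gadget' vertex outside `A ∪ {o, b}` adjacent to `o`,
  AND (KN §5.6(4)) WLOG `A = {v : P(v ↔ b) ≥ 1 − t}` is a superlevel set of `h := P(· ↔ b)` with
  `h(o) < 1 − t`; reformulation: AG ⇔ ∀θ, `P(o ↮ L_θ) ≥ θ − h(o)` where `L_θ = {h ≥ θ}`.
* LANDED / AT THE GATE (Negative/ lane, `--supports stmt-CriticalPhenomena-4576`): `Negative/LoadBearing.lean`
  (p84834: the three falsity witnesses of (a)/(c) and the equality case (b), statements inline) and
  `Negative/EdgeDeletion.lean` (p85266: the exact identity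
  `P_w(E) − P_w(F_a) = (1 − w(oa))·(P_{w[oa↦0]}(E) − P_{w[oa↦0]}(F_a))` for an `o`-adjacent relay `a` —
  the comparison with an adjacent relay is decided in the graph WITHOUT the joining edge).
* (f) reliable-limit theory (lex criterion, (Q), ≤ 2 minimal o-sets, tie families) and (g) the exact
  computational record are the two bottom docblocks.
* (e) WHY IT RESISTS / search record (bottom docblock): exploration argument shows a violation needs
  the deletion of `o`'s low-`h` cluster to damage the entry points' connection to `b` by more than
  `max_a P(a ↮ b)`; stars, double stars, hub/spoke trees, split graphs are provably fine by hand
  (ratios ≤ 1/e … 4/9, → 1 only in the degenerate gluing `o ≡ a`); certified searches: planner toy sweep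
  (n ≤ 6 exhaustive × 4 weights, 6800 random on 6–7: none), refuter rreview kit j001007 (≤ 7 exhaustive ×
  5 weightings + 3000 gadget graphs on 8–9), THIS unit: kit j004907 (continuous weight optimisation on
  K_n, n = 6..10, exact DP), kit j004909 (hypergraph analogue, n = 5..8) — results appended below as they land.
-/

namespace Summit.CriticalPhenomena.PercolationContinuityZ3.Cruxes.AdditiveGluing.Disproof

open MeasureTheory Set
open Literature.Probability.LatticeModels Literature.Probability.Percolation
open Summit.CriticalPhenomena.PercolationContinuityZ3.Theses.PercNearOneGluing (AdditiveGluing)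

/-! ## 0. The crux pointwise, and basic facts about the model -/

/-- `AdditiveGluing` at one instance `(n, w, A, o, b, t)`. [folklore] -/
def AGAt (n : ℕ) (w : Sym2 (Fin n) → unitInterval) (A : Finset (Fin n)) (o b : Fin n) (t : ℝ) : Prop :=
  0 ≤ t → (∀ a ∈ A, 1 - t ≤ (prodBernoulli w).real (openConn a b)) →
    (prodBernoulli w).real (⋃ a ∈ A, openConn o a) - t ≤ (prodBernoulli w).real (openConn o b)

/-- The crux is the universal closure of `AGAt`. [folklore] -/
theorem additiveGluing_iff : AdditiveGluing ↔ ∀ n w A o b t, AGAt n w A o b t := Iff.rfl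

/-- `{o ↔ o}` is the sure event. [folklore] -/
theorem openConn_self {n : ℕ} (o : Fin n) : (openConn o o : Set (BondConfig (Fin n))) = univ := by
  ext ω; simp [openConn]

/-- In the empty configuration only trivial connections hold. [folklore] -/
theorem empty_mem_openConn_iff {n : ℕ} (x y : Fin n) :
    (∅ : BondConfig (Fin n)) ∈ openConn x y ↔ x = y := by
  simp [openConn, openGraph]

/-- All weights zero: the percolation measure is the point mass at the empty configuration. [folklore] -/
theorem prodBernoulli_zero {n : ℕ} :
    prodBernoulli (fun _ : Sym2 (Fin n) => (0 : unitInterval)) = Measure.dirac ∅ := by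
  rw [prodBernoulli_const]; exact ProbabilityTheory.setBernoulli_zero _

/-- Under zero weights, `P(x ↔ y) = 1` if `x = y` and `0` otherwise. [folklore] -/
theorem prodBernoulli_zero_real_openConn {n : ℕ} (x y : Fin n) :
    (prodBernoulli (fun _ : Sym2 (Fin n) => (0 : unitInterval))).real (openConn x y) =
      if x = y then 1 else 0 := by
  rw [prodBernoulli_zero, measureReal_def,
    Measure.dirac_apply' _ (measurableSet_openConn_holds x y)]
  by_cases h : x = y
  · simp [h, Set.indicator, (empty_mem_openConn_iff y y).2 rfl]
  · simp [h, Set.indicator, empty_mem_openConn_iff]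

/-- If `o ∈ A` then `{o ↔ A}` is the sure event. [folklore] -/
theorem iUnion_openConn_eq_univ_of_mem {n : ℕ} {A : Finset (Fin n)} {o : Fin n} (ho : o ∈ A) :
    (⋃ a ∈ A, (openConn o a : Set (BondConfig (Fin n)))) = univ := by
  apply Set.eq_univ_of_univ_subset
  rw [← openConn_self o]
  exact Set.subset_iUnion₂ (s := fun a (_ : a ∈ A) => (openConn o a : Set (BondConfig (Fin n)))) o ho

/-- If `o ∈ A` then `P(o ↔ A) = 1`. [folklore] -/
theorem real_iUnion_openConn_eq_one_of_mem {n : ℕ} (w : Sym2 (Fin n) → unitInterval)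
    {A : Finset (Fin n)} {o : Fin n} (ho : o ∈ A) :
    (prodBernoulli w).real (⋃ a ∈ A, openConn o a) = 1 := by
  rw [iUnion_openConn_eq_univ_of_mem ho]; exact probReal_univ

/-! ## (a) Load-bearing hypotheses: each one is needed -/

/-- The crux with the hypothesis `0 ≤ t` DROPPED. [folklore] -/
def AdditiveGluingWithoutNonneg : Prop :=
  ∀ (n : ℕ) (w : Sym2 (Fin n) → unitInterval) (A : Finset (Fin n)) (o b : Fin n) (t : ℝ),
    (∀ a ∈ A, 1 - t ≤ (prodBernoulli w).real (openConn a b)) →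
      (prodBernoulli w).real (⋃ a ∈ A, openConn o a) - t ≤ (prodBernoulli w).real (openConn o b)

/-- `0 ≤ t` is load-bearing, but ONLY through the empty relay set: with `A = ∅` the relay hypothesis is
vacuous and `t = −2` makes the conclusion read `0 + 2 ≤ P(o ↔ b) ≤ 1`. (For `A ≠ ∅` the relay hypothesis
itself forces `t ≥ 0`, so provers lose nothing by assuming `A.Nonempty`.) [folklore] -/
theorem additiveGluing_false_without_nonneg : ¬ AdditiveGluingWithoutNonneg := by
  intro h
  have h1 := h 1 (fun _ => 0) ∅ 0 0 (-2) (by simp)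
  have h2 : (prodBernoulli (fun _ : Sym2 (Fin 1) => (0 : unitInterval))).real (openConn 0 0) ≤ 1 :=
    measureReal_le_one
  simp at h1
  linarith

/-- The crux with the RELAY hypothesis `∀ a ∈ A, 1 − t ≤ P(a ↔ b)` DROPPED. [folklore] -/
def AdditiveGluingWithoutRelay : Prop :=
  ∀ (n : ℕ) (w : Sym2 (Fin n) → unitInterval) (A : Finset (Fin n)) (o b : Fin n) (t : ℝ), 0 ≤ t →
    (prodBernoulli w).real (⋃ a ∈ A, openConn o a) - t ≤ (prodBernoulli w).real (openConn o b)

/-- The relay hypothesis is load-bearing: two vertices, all weights `0`, `A = {o}`, `b ≠ o`, `t = 0`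
gives `P(o ↔ A) − t = 1 > 0 = P(o ↔ b)`. [folklore] -/
theorem additiveGluing_false_without_relay : ¬ AdditiveGluingWithoutRelay := by
  intro h
  have h1 := h 2 (fun _ => 0) {0} 0 1 0 le_rfl
  rw [real_iUnion_openConn_eq_one_of_mem _ (Finset.mem_singleton_self 0),
    prodBernoulli_zero_real_openConn] at h1
  norm_num at h1

/-! ## (b) Tightness: the degenerate gluing `o ∈ A` is the equality case -/

/-- If `o ∈ A`, the smallest admissible slack is `t₀ = max_a P(a ↮ b) ≥ P(o ↮ b)`, and at
`t = P(o ↮ b)` (admissible iff `o` is the worst-connected relay) BOTH sides of the crux coincide: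
`P(o ↔ A) − (1 − P(o ↔ b)) = P(o ↔ b)`. So the constant `1` in front of `t` cannot be lowered and no
uniform gain `P(o ↔ A) − t + c ≤ P(o ↔ b)` (`c > 0`) is possible. [folklore] -/
theorem additiveGluing_eq_of_mem {n : ℕ} (w : Sym2 (Fin n) → unitInterval) {A : Finset (Fin n)}
    {o : Fin n} (b : Fin n) (ho : o ∈ A) :
    (prodBernoulli w).real (⋃ a ∈ A, openConn o a) - (1 - (prodBernoulli w).real (openConn o b)) =
      (prodBernoulli w).real (openConn o b) := by
  rw [real_iUnion_openConn_eq_one_of_mem w ho]; ring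

/-- … and the crux HOLDS whenever `o ∈ A` (the relay hypothesis at `a = o` is the conclusion). [folklore] -/
theorem additiveGluing_of_mem {n : ℕ} (w : Sym2 (Fin n) → unitInterval) {A : Finset (Fin n)}
    {o : Fin n} (b : Fin n) (t : ℝ) (ho : o ∈ A) : AGAt n w A o b t := by
  intro _ hA
  have := hA o ho
  rw [real_iUnion_openConn_eq_one_of_mem w ho]
  linarith

/-! ## (c) Natural strengthenings that are FALSE -/

/-- STRENGTHENING 1 (false): replace `max_{a∈A} P(a ↮ b) ≤ t` by the AVERAGE failure
`(∑_{a∈A} P(a ↮ b)) / |A| ≤ t`. [folklore] -/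
def AdditiveGluingAvg : Prop :=
  ∀ (n : ℕ) (w : Sym2 (Fin n) → unitInterval) (A : Finset (Fin n)) (o b : Fin n) (t : ℝ), 0 ≤ t →
    (∑ a ∈ A, (1 - (prodBernoulli w).real (openConn a b))) / A.card ≤ t →
      (prodBernoulli w).real (⋃ a ∈ A, openConn o a) - t ≤ (prodBernoulli w).real (openConn o b)

/-- The average version fails already with 0/1 weights: two isolated vertices `o = 0`, `b = 1`,
`A = {0, 1}`: failures `P(0 ↮ 1) = 1`, `P(1 ↮ 1) = 0`, average `1/2 =: t`, but
`P(o ↔ A) − t = 1/2 > 0 = P(o ↔ b)`. So the inequality does not 'linearise' over the relay set: the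
worst relay alone must carry it (cf. KN Question 5 on convex coefficients `c_a`). [folklore] -/
theorem not_additiveGluingAvg : ¬ AdditiveGluingAvg := by
  intro h
  have h1 := h 2 (fun _ => 0) {0, 1} 0 1 (1 / 2) (by norm_num)
  rw [real_iUnion_openConn_eq_one_of_mem _ (by simp), Finset.sum_pair (by decide),
    prodBernoulli_zero_real_openConn, prodBernoulli_zero_real_openConn, Finset.card_pair (by decide)] at h1
  norm_num at h1

/- STRENGTHENING 2 (false, recorded as a computation; not typed here because Literature has no
directed percolation): `directed_analogue_fails`.  Directed graph on {o, a₁, a₂, a₃, b}: arcs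
o → aᵢ (prob r = 1/2), aᵢ → b (prob 1/2), aᵢ → o (prob 1).  Then with u := 1 − r(1 − q) = 3/4,
q := 1/2:  P(o → A, o ↛ b) = u³ − (1 − r)³ = 27/64 − 8/64 = 19/64, while
P(aᵢ ↛ b) = q · u² = 18/64 for every i.  So the directed additive gluing inequality FAILS (margin
1/64), for |A| = 3 on 5 vertices; for |A| = k the same family violates iff (1 − q) > ((1−r)/u)^{k−1},
so the violation RATIO → u/q (unbounded as q → 0) while KN's Fig. 4 example (k = 2) does NOT violate
the additive form (7/16 ≥ 12/16 − 6/16).  Moral: any proof of AG must use the symmetry of `↔`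
(the arcs aᵢ → o of weight 1 let aᵢ inherit o's routes without o inheriting aᵢ's). -/

/-! ## (d) Positive special cases (evidence for provers; a refuter cannot land these) -/

/-- `{o ↔ a} ⊆ {o ↔ b} ∪ {a ↔ b}ᶜ` (transitivity of open connection). [folklore] -/
theorem openConn_subset_union_compl {n : ℕ} (o a b : Fin n) :
    (openConn o a : Set (BondConfig (Fin n))) ⊆ openConn o b ∪ (openConn a b)ᶜ := by
  intro ω hoa
  by_cases hab : ω ∈ openConn a b
  · left
    simp only [openConn, Set.mem_setOf_eq] at hoa hab ⊢
    exact hoa.trans hab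
  · right; exact hab

/-- The union bound `P(o ↔ a) ≤ P(o ↔ b) + P(a ↮ b)`. [folklore] -/
theorem real_openConn_le_add {n : ℕ} (w : Sym2 (Fin n) → unitInterval) (o a b : Fin n) :
    (prodBernoulli w).real (openConn o a) ≤
      (prodBernoulli w).real (openConn o b) + (1 - (prodBernoulli w).real (openConn a b)) := by
  calc (prodBernoulli w).real (openConn o a)
      ≤ (prodBernoulli w).real (openConn o b ∪ (openConn a b)ᶜ) :=
        measureReal_mono (openConn_subset_union_compl o a b)
    _ ≤ (prodBernoulli w).real (openConn o b) + (prodBernoulli w).real ((openConn a b)ᶜ) :=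
        measureReal_union_le _ _
    _ = _ := by rw [probReal_compl_eq_one_sub (measurableSet_openConn_holds a b)]

/-- `AdditiveGluing` holds for `|A| ≤ 1` (for `A = ∅` trivially, for `A = {a}` it IS the union bound).
Together with KN Theorem 1 (|A| = 2, in print, not formalised) any counterexample has `|A| ≥ 3`. [folklore] -/
theorem additiveGluing_of_card_le_one {n : ℕ} (w : Sym2 (Fin n) → unitInterval) (A : Finset (Fin n))
    (o b : Fin n) (t : ℝ) (hA : A.card ≤ 1) : AGAt n w A o b t := by
  intro ht hrel
  haveI : Nonempty (Fin n) := ⟨o⟩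
  rcases Finset.card_le_one_iff_subset_singleton.1 hA with ⟨a, ha⟩
  rcases Finset.subset_singleton_iff.1 ha with rfl | rfl
  · simp only [Finset.notMem_empty, Set.iUnion_of_empty, Set.iUnion_empty, measureReal_empty]
    linarith [measureReal_nonneg (μ := prodBernoulli w) (s := openConn o b)]
  · have h1 := hrel a (Finset.mem_singleton_self a)
    have h2 := real_openConn_le_add w o a b
    simp only [Finset.mem_singleton, Set.iUnion_iUnion_eq_left]
    linarith

/-- The DIFFERENCE form provers should aim at: it suffices to bound the single event
`E = {o ↔ A} \ {o ↔ b}` (`= ⋃_{a∈A} {o ↔ a} ∩ {a ↮ b}`) by the worst relay failure. [folklore] -/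
theorem agAt_of_diff_le {n : ℕ} (w : Sym2 (Fin n) → unitInterval) (A : Finset (Fin n)) (o b : Fin n)
    (t : ℝ)
    (h : (prodBernoulli w).real ((⋃ a ∈ A, openConn o a) \ openConn o b) ≤ t) : AGAt n w A o b t := by
  intro _ _
  have : (prodBernoulli w).real (⋃ a ∈ A, openConn o a) ≤
      (prodBernoulli w).real ((⋃ a ∈ A, openConn o a) \ openConn o b) +
        (prodBernoulli w).real (openConn o b) := by
    calc (prodBernoulli w).real (⋃ a ∈ A, openConn o a)
        ≤ (prodBernoulli w).real (((⋃ a ∈ A, openConn o a) \ openConn o b) ∪ openConn o b) :=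
          measureReal_mono (fun ω hω => by
            by_cases hb : ω ∈ openConn o b
            · exact Or.inr hb
            · exact Or.inl ⟨hω, hb⟩)
      _ ≤ _ := measureReal_union_le _ _
  linarith

/-! ## (e) Near-misses and why the crux resists (record; no `sorry` needed so far)

* HAND FAMILIES (all satisfy AG; ratio := P(E) / max_a P(a ↮ b)):
  - star `o –r– aᵢ –(1−q)– b` (k leaves): P(E) = (1 − r(1−q))^k − (1−r)^k; ratio ≤ λe^{−λ} ≤ 1/e for
    r = λ/k, and < 1 for all (r, q, k) (direct algebra).
  - double star / hub–spoke trees `o –(1−η)– aᵢ –(1−q)– b`: P(E) − P(aᵢ ↮ b) = η[u^{k−1} − η^{k−1} − q],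
    u = q + η − qη, which is < 0 for k ≥ 2; sup ratio = ((k−2)/(k−1))^{k−2} → 1/e (k ≥ 3), 4/9 at k = 4.
  - trees of such blocks compose to the same inequality (series–parallel reduction).
  - EQUALITY only in the degenerate gluing `o ∈ A` / an `o–a` edge of weight 1 (`additiveGluing_eq_of_mem`).
* STRUCTURE any counterexample must have (from print + the above): |A| ≥ 3 (KN Thm 1); `o` has a
  neighbour outside `A ∪ {b}` (KN Thm 4) and is not an `o–x–A` pendant (KN Thm 5); WLOG `b ∉ N(o)` is NOT
  available for AG (KN §5.6(3) uses concavity, AG's slack is a min of affine functions of each weight,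
  i.e. concave — fine — but the max over `a` moves); WLOG `A` = superlevel set of `h = P(· ↔ b)`;
  no weight equals 1 (contract) — so a certified search may use the box `[0, 1 − η]`.
* EXPLORATION HEURISTIC (why it resists): explore `W` = the cluster of `o` in the low set `{h < θ}`
  stopped at `L = {h ≥ θ}`; given `W`, `o ↔ b` iff some entry point `a ∈ W ∩ L` reaches `b` in
  `G − (W \ L)`.  AG would follow if deleting the explored LOW vertices never raised an entry point's
  failure probability above `max_a P_G(a ↮ b)`; a counterexample therefore needs relays whose routes
  to `b` run through many low-`h` vertices near `o` — 'parallel low routes' — which is exactly what the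
  weight optimiser (kit j004907) is free to build with its gadget vertices.
* DIRECTED analogue: FALSE (above).  HYPERGRAPH analogue: kit j004909 (pending at the time of writing).
-/

/-! ## (f) The reliable-network limit: an exact combinatorial criterion (this unit, on paper)

Put every edge `e` of a multigraph in the graph with weight `1 − ε` (parallel edges = independent copies;
a pair of capacity `k` is one edge of weight `1 − ε^k`).  For an event `V` determined by the set `Z` of CLOSED
edges, `P(V) = Σ_k M_k(V) ε^k (1 − ε)^{m−k}` with `M_k(V) = #{Z : |Z| = k, V holds when exactly Z is closed}`.
* `F_a = {a ↮ b}` is monotone in `Z`; its first non-zero coefficient sits at `k = λ(a,b)` (edge connectivity)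
  and equals `N_a = #{minimum (a,b)-cuts}`.
* `E = {o ↔ A, o ↮ b}` is NOT monotone in `Z` (closing more edges can detach `o` from `A`).
* LEX CRITERION.  `AG` fails for all sufficiently small `ε` iff for every `a ∈ A`:
  `(M_k(E))_k >_lex (M_k(F_a))_k`.  WLOG (KN §5.6(4)) `A` is a superlevel set of connectivity-to-`b`, i.e. an
  initial segment of the vertices sorted by `(M_k(F_v))_k` in increasing lex order.
* LEADING ORDER = a pure min-cut counting question (Q): with `c = min_{a∈A} λ(a,b)`,
  `N_E := #{S : o ∈ S, b ∉ S, |∂S| = c, S ∩ A_c ≠ ∅}` versus `max_{a∈A_c} N_a`, `A_c = {a ∈ A : λ(a,b) = c}`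
  (for connected `G`, cost-`c` vertex sets and minimum edge cuts correspond bijectively).
  Uncrossing facts (sub/posi-modularity of `|∂·|`): (i) if `T` is an inclusion-minimal `o`-set then every
  `o`-set either contains `T` or is relay-disjoint from `T`; (ii) for an `o`-set `X ⊉ T` with trace
  `Q = X ∩ T`: `|∂Q| = 2s`, `w(Q, T∖Q) = w(Q, X∖Q) = s`, `w(Q, V∖(T∪X)) = 0`, hence `X ∖ T` and `T ∖ X` are
  again cost-`c` sets (relay-sets AVOIDING `o`); (iii) a 'common core' shared by ≥ 3 lobes is impossible
  (the core would need half of its boundary towards each lobe); (iv) two lobes: the maps `X ↦ X ∖ U` give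
  `α(a₁) ≤ β(a₂)`, `α(a₂) ≤ β(a₁)` (`α(a)` = #o-sets avoiding `a`, `β(a)` = #a-sets avoiding `o`,
  `N_E − N_a = α(a) − β(a)`), so NOT both relays can be beaten.  Worked TIE families (N_E = max N_a exactly,
  never strict): cycles `C_N` with `o` antipodal to `b` and `A ∋` the neighbours of `o`
  (`N_E = N_{o±1} = (N/2)² − 1`), theta graphs / cacti, 'robust `o`' variants.  CONJECTURE: (Q) always holds
  (ties allowed) — then the reliable limit is decided at order `c+1`, where in a tie the `(m−c)N` terms cancel
  and one compares `M_{c+1}(E)` with `M_{c+1}(F_{a*})` directly; `E` pays a FRAGILITY term (extra closed edge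
  detaching `o` from `A`) that `F_a` never pays.  Cycle: `P(E) − P(F_{o+1}) = −ε²(1 − (1−ε)^{N/2−1})`
  (order ε³, coefficient `−(N/2 − 1)` = convexity gain `N/2−1` minus fragility `N−2`); cycle with triple edges
  at `o`: the tie persists through order 6 and `P(E) − P(F_a) = −ℓ τ²` exactly (`ℓ` = P(left unit cut),
  `τ = ε³`), still negative.  So in this corner AG is razor-tight but has not broken; kit j005461 (Q exhaustive
  n ≤ 7 / hill-climb n ≤ 9) and kit j005596 (full lex vectors, exhaustive simple n ≤ 6, annealing n ≤ 12,
  m ≤ 18) test it mechanically; kit j005809 optimises exact probabilities on sparse topologies n ≤ 13.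
* The UNRELIABLE limit (all weights → 0) is trivially fine for AG (`P(o ↔ A) → 0`), and mixed blob/weak
  structures reduce to it on the quotient — so counterexamples, if any, live at intermediate weights or at
  second order near the reliable limit.
-/

/-! ## (g) Certified / exact computational record (kit jobs of this unit, 2026-08-16; all exact DP or
exact integer counting unless stated; every job attaches `compute-<id>.json` to the crux item)

* K_n WEIGHT OPTIMISER (exact partition DP, exact per-coordinate affine line search; o = 0, b = 1,
  A = {2..k+1}, ≥ 1 gadget vertex): j014047 (n = 6,7,8; 3425 restarts), j014048 (n = 9; 80 restarts),
  j014049 (HYPERGRAPH analogue, all triples available, n = 5,6,7; 13316 restarts): **0 violations** of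
  AG, of KN Conj 1, of KN Conj 2 and of (3).  Plain objectives are maximised only by DEGENERATE gluing
  (o joined to the worst relay by redundant 0.98-paths: `P(o ↔ A) = 1 − 1e−7`, `P(E) = max F − 1e−12`),
  i.e. the sup of the slack over the open box is `0⁻`, approached only through `o ≡ a*`.
  Scale-free reformulation used from wave 3 on: with `X := P(E \ F_{a*}) = P(o ↔ A, o ↮ b, a* ↔ b)` and
  `Y := P(F_{a*} \ E) = P(a* ↮ b, o ↔ b) + P(a* ↮ b, o ↮ A ∪ {b})` (a* the worst relay) the crux is
  `X ≤ Y`; gluing sends both to 0 without forcing `X/Y → 1`.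
* RELIABLE LIMIT, leading order (Q) (pure min-cut counting, exact integers): j014450 — EXHAUSTIVE over all
  1 027 080 connected multigraphs on 5 labelled vertices with pair capacities ≤ 3 (b = 0, o = 1, every
  relay subset): **0 Q-violations**; hill-climbing n = 6,7,8 (2221 restarts): ties (`N_E = max N_a`) only.
* RELIABLE LIMIT, full lex criterion (exact integer M-vectors): j014451 — EXHAUSTIVE over all connected
  simple graphs on n ≤ 6 labelled vertices (all placements of o, b): **0 violations**, best normalised
  margin −0.0023 (n = 6); annealing over multigraphs n = 7,8,9, m ≤ 16 (995 restarts): best margins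
  ≈ −4·10⁻⁵, i.e. ties through order 7–8 broken AGAINST `E` by one or two configurations out of ~5·10⁴ —
  always with many parallel edges at `o` ('robust o' pushes the tie deeper, never flips it; cf. §(f)).
* SPARSE EXACT OPTIMISER on a structured zoo (wheels / double wheels = 'o inside a ring, b outside',
  prisms, Möbius ladders, Petersen, cube, grids, theta graphs, circulants, two-ring) + random sparse
  topologies n ≤ 12, m ≤ 19, weights ∈ [0.02, 0.98]: j014452 (63 units): **0 violations**.
Wave 3 (hypergraph zoo: Fano plane, AG(2,3), octahedron faces, sunflowers, 3-edge strips; rho objective;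
(Q) exhaustive n = 7 simple; lex annealing n ≤ 10) is recorded in NOTES.md / later revisions of this file.
-/

end Summit.CriticalPhenomena.PercolationContinuityZ3.Cruxes.AdditiveGluing.Disproof
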